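import Literature.NumberTheory.Automorphic.EichlerOrderAtkinLehnerIdeal
import Literature.NumberTheory.Automorphic.QuaternionLocalSplitIdealCount
import HarnessLib

/-!
# Route `RamifiedHeegnerPair`, crux U₁ `LeafRankOneUpperAtThree` (stmt-BirchSwinnertonDyer-26022), line `partnerdescent` —
# the Hecke–Atkin–Lehner twist (HT) from the tree, part 6: the Atkin–Lehner conjugate of the dual generator
# `Z' = ℓ · W⁻¹ Z⁻¹ W` is forward iff `Z` is (`p`-adic `2 × 2` bookkeeping only)

HONEST FRAMING. Theorems only; helper file (`--supports stmt-BirchSwinnertonDyer-26022`); pure `p`-adic linear algebra over `ℚ_ℓ`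
(no quaternion algebra, no named fact, no `sorry`); nothing booked; BSD is proved for no curve. Lead prover bsd-line-rhp-p2 g65,
2026-08-31.

WHAT. Let `W` be Atkin–Lehner-shaped at level `ℓ^e` (`AtkinLehner.IsALShape`, ‹EichlerOrderAtkinLehnerIdeal›: the local generator
`w ≡ (0 1; ℓ^e 0)` of `𝔔_{ℓ^e}`) with `‖det W‖ = ℓ^{-e}`, `e ≥ 1`, and let `Z` be level-shaped with `‖det Z‖ = ℓ⁻¹` (a generator of a right
ideal of index `ℓ²`). Eichler's conjugate-ideal bijection `α ↦ ℓ α⁻¹` followed by the Atkin–Lehner involution `J ↦ J 𝔔` replaces the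
local generator `Z` by `Z' = ℓ · W⁻¹ Z⁻¹ W` (part 7). Here: **`‖Z'₀₀‖ = 1 ↔ ‖Z₀₀‖ = 1`** (`norm_twistDual_apply_zero_zero_eq_one_iff`) — the
`(0,0)` entry of `adj(W) adj(Z) W` is `-W₀₁ W₁₀ Z₀₀ + O(ℓ^{-2e})` with `‖W₀₁ W₁₀‖ = ℓ^{-e}` — so FORWARD sub-ideals go to FORWARD
sub-ideals: the `U_ℓ`-correspondence is self-adjoint for Gross's pairing twisted by `W_{ℓ⁺}` (W. Zhang 2014 §3.9; Mazur 1977 II §15).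
[cite: WZhang2014, §3.9 p. 214] [cite: Mazur1977, II §15] [cite: VignerasLNM800, Ch. II §2]
-/

set_option linter.dupNamespace false
set_option autoImplicit false

noncomputable section

namespace Summit.BirchSwinnertonDyer.BirchSwinnertonDyer.Theorems.LeafPartnerOrders

open Literature.NumberTheory.Automorphic Literature.NumberTheory.Automorphic.AtkinLehner

variable {ℓ : ℕ} [hℓ : Fact ℓ.Prime] {e : ℕ}

/-! ### `p`-adic bookkeeping -/

/-- `0 < ℓ^{-n}`. [folklore] -/
private theorem zpow_neg_pos'' (n : ℕ) : 0 < (ℓ : ℝ) ^ (-(n : ℤ)) := zpow_pos (by exact_mod_cast hℓ.out.pos) _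

/-- `ℓ^{-n} ≤ 1`. [folklore] -/
private theorem zpow_neg_le_one'' (n : ℕ) : (ℓ : ℝ) ^ (-(n : ℤ)) ≤ 1 :=
  zpow_le_one_of_nonpos₀ (by exact_mod_cast hℓ.out.one_lt.le) (by omega)

/-- `ℓ^{-m} ≤ ℓ^{-n}` for `n ≤ m`. [folklore] -/
private theorem zpow_neg_le_zpow_neg'' {m n : ℕ} (h : n ≤ m) : (ℓ : ℝ) ^ (-(m : ℤ)) ≤ (ℓ : ℝ) ^ (-(n : ℤ)) :=
  zpow_le_zpow_right₀ (by exact_mod_cast hℓ.out.one_lt.le) (by omega)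

/-- `ℓ^{-m} < ℓ^{-n}` for `n < m`. [folklore] -/
private theorem zpow_neg_lt_zpow_neg'' {m n : ℕ} (h : n < m) : (ℓ : ℝ) ^ (-(m : ℤ)) < (ℓ : ℝ) ^ (-(n : ℤ)) :=
  zpow_lt_zpow_right₀ (by exact_mod_cast hℓ.out.one_lt) (by omega)

/-- `ℓ^{-e} · ℓ^{-e} = ℓ^{-2e}`. [folklore] -/
private theorem zpow_neg_mul_self (e : ℕ) : (ℓ : ℝ) ^ (-(e : ℤ)) * (ℓ : ℝ) ^ (-(e : ℤ)) = (ℓ : ℝ) ^ (-((2 * e : ℕ) : ℤ)) := by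
  rw [← zpow_add₀ (by exact_mod_cast hℓ.out.ne_zero : (ℓ : ℝ) ≠ 0)]
  congr 1; push_cast; ring

/-- `‖a b + c d‖ ≤ t` from `‖a‖‖b‖ ≤ t`, `‖c‖‖d‖ ≤ t`. [folklore] -/
private theorem norm_add_mul_le'' {a b c d : ℚ_[ℓ]} {t : ℝ} (h₁ : ‖a‖ * ‖b‖ ≤ t) (h₂ : ‖c‖ * ‖d‖ ≤ t) : ‖a * b + c * d‖ ≤ t :=
  (IsUltrametricDist.norm_add_le_max _ _).trans (max_le (by rw [norm_mul]; exact h₁) (by rw [norm_mul]; exact h₂))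

/-- `‖x - y‖ ≤ max ‖x‖ ‖y‖` (ultrametric). [folklore] -/
private theorem norm_sub_le_max'' (x y : ℚ_[ℓ]) : ‖x - y‖ ≤ max ‖x‖ ‖y‖ := by
  rw [sub_eq_add_neg, ← norm_neg y]; exact IsUltrametricDist.norm_add_le_max _ _

/-- `‖x y z‖ ≤ r s t` from `‖x‖ ≤ r`, `‖y‖ ≤ s`, `‖z‖ ≤ t`. [folklore] -/
private theorem norm_mul3_le {x y z : ℚ_[ℓ]} {r s t : ℝ} (hx : ‖x‖ ≤ r) (hy : ‖y‖ ≤ s) (hz : ‖z‖ ≤ t) :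
    ‖x * y * z‖ ≤ r * s * t := by
  rw [norm_mul, norm_mul]
  have hr : 0 ≤ r := (norm_nonneg _).trans hx
  have hs : 0 ≤ s := (norm_nonneg _).trans hy
  exact mul_le_mul (mul_le_mul hx hy (norm_nonneg _) hr) hz (norm_nonneg _) (mul_nonneg hr hs)

/-- In `ℚ_ℓ`: `‖x‖ < 1 ↔ ‖x‖ ≤ ℓ⁻¹`. [folklore] -/
private theorem norm_lt_one_iff_le_inv' (x : ℚ_[ℓ]) : ‖x‖ < 1 ↔ ‖x‖ ≤ (ℓ : ℝ)⁻¹ := by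
  rw [← zpow_neg_one, Padic.norm_le_pow_iff_norm_lt_pow_add_one]
  norm_num

/-! ### The `(0,0)` entry of `adj(W) adj(Z) W` -/

/-- The `(0,0)` entry of `adj(W) adj(Z) W` for `2 × 2` matrices: `-W₀₁ W₁₀ Z₀₀ + (W₀₀ W₁₁ Z₁₁ + W₀₀ W₀₁ Z₁₀ - W₁₀ W₁₁ Z₀₁)`. [folklore] -/
theorem adjugate_mul_adjugate_mul_apply_zero_zero (W Z : Matrix (Fin 2) (Fin 2) ℚ_[ℓ]) :
    (W.adjugate * Z.adjugate * W) 0 0 =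
      -(W 0 1 * W 1 0 * Z 0 0) + (W 0 0 * W 1 1 * Z 1 1 + W 0 0 * W 0 1 * Z 1 0 - W 1 0 * W 1 1 * Z 0 1) := by
  rw [Matrix.adjugate_fin_two, Matrix.adjugate_fin_two, Matrix.mul_apply, Fin.sum_univ_two, Matrix.mul_apply,
    Matrix.mul_apply, Fin.sum_univ_two, Fin.sum_univ_two]
  simp; ring

/-- `W⁻¹ Z⁻¹ W = (det W)⁻¹ (det Z)⁻¹ · adj(W) adj(Z) W`. [folklore] -/
theorem inv_mul_inv_mul_eq_smul (W Z : Matrix (Fin 2) (Fin 2) ℚ_[ℓ]) :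
    W⁻¹ * Z⁻¹ * W = ((W.det)⁻¹ * (Z.det)⁻¹) • (W.adjugate * Z.adjugate * W) := by
  rw [Matrix.inv_def, Matrix.inv_def]
  simp only [Ring.inverse_eq_inv', Matrix.smul_mul, Matrix.mul_smul, smul_smul, mul_comm (Z.det)⁻¹]

/-- **For an Atkin–Lehner-shaped `W` with `‖det W‖ = ℓ^{-e}` (`e ≥ 1`): `‖W₀₁ W₁₀‖ = ℓ^{-e}`** (`‖W₀₀ W₁₁‖ ≤ ℓ^{-2e} < ℓ^{-e} = ‖det W‖`). [folklore] -/
theorem norm_apply_zero_one_mul_apply_one_zero (he : 1 ≤ e) {W : Matrix (Fin 2) (Fin 2) ℚ_[ℓ]} (hW : IsALShape e W)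
    (hdet : ‖W.det‖ = (ℓ : ℝ) ^ (-(e : ℤ))) : ‖W 0 1 * W 1 0‖ = (ℓ : ℝ) ^ (-(e : ℤ)) := by
  obtain ⟨h00, -, -, h11⟩ := hW
  have hsmall : ‖W 0 0 * W 1 1‖ < (ℓ : ℝ) ^ (-(e : ℤ)) := by
    rw [norm_mul]
    calc ‖W 0 0‖ * ‖W 1 1‖ ≤ (ℓ : ℝ) ^ (-(e : ℤ)) * (ℓ : ℝ) ^ (-(e : ℤ)) :=
          mul_le_mul h00 h11 (norm_nonneg _) (zpow_neg_pos'' e).le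
      _ = (ℓ : ℝ) ^ (-((2 * e : ℕ) : ℤ)) := zpow_neg_mul_self e
      _ < (ℓ : ℝ) ^ (-(e : ℤ)) := zpow_neg_lt_zpow_neg'' (by omega)
  rw [Matrix.det_fin_two] at hdet
  -- `W₀₁ W₁₀ = W₀₀ W₁₁ - det W`
  have e1 : W 0 1 * W 1 0 = W 0 0 * W 1 1 + -(W 0 0 * W 1 1 - W 0 1 * W 1 0) := by ring
  have hne : ‖W 0 0 * W 1 1‖ ≠ ‖-(W 0 0 * W 1 1 - W 0 1 * W 1 0)‖ := by rw [norm_neg, hdet]; exact hsmall.ne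
  rw [e1, IsUltrametricDist.norm_add_eq_max_of_norm_ne_norm hne, norm_neg, hdet, max_eq_right hsmall.le]

/-- **The Atkin–Lehner conjugate of the dual generator is forward iff the generator is.** Let `W` be Atkin–Lehner-shaped at level
`ℓ^e` (`e ≥ 1`) with `‖det W‖ = ℓ^{-e}`, `Z` level-shaped with `‖det Z‖ = ℓ⁻¹`, and `Z' = ℓ · W⁻¹ Z⁻¹ W`. Then `‖Z'₀₀‖ = 1 ↔ ‖Z₀₀‖ = 1`.
(`Z'₀₀ = ℓ (det W)⁻¹ (det Z)⁻¹ · (-W₀₁ W₁₀ Z₀₀ + R)`, `‖R‖ ≤ ℓ^{-2e}`, `‖W₀₁ W₁₀‖ = ℓ^{-e}`, and the prefactor has norm `ℓ^e`.)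
[cite: WZhang2014, §3.9 p. 214] [cite: Mazur1977, II §15] -/
theorem norm_twistDual_apply_zero_zero_eq_one_iff (he : 1 ≤ e) {W Z : Matrix (Fin 2) (Fin 2) ℚ_[ℓ]} (hW : IsALShape e W)
    (hWdet : ‖W.det‖ = (ℓ : ℝ) ^ (-(e : ℤ))) (hZ : IsLevelShape e Z) (hZdet : ‖Z.det‖ = (ℓ : ℝ) ^ (-((1 : ℕ) : ℤ))) :
    ‖((ℓ : ℚ_[ℓ]) • (W⁻¹ * Z⁻¹ * W)) 0 0‖ = 1 ↔ ‖Z 0 0‖ = 1 := by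
  set r := (ℓ : ℝ) ^ (-(e : ℤ))
  set r₂ := (ℓ : ℝ) ^ (-((2 * e : ℕ) : ℤ))
  have hℓ0 : (ℓ : ℝ) ≠ 0 := by exact_mod_cast hℓ.out.ne_zero
  have hr0 := zpow_neg_pos'' (ℓ := ℓ) e
  have hr1 := zpow_neg_le_one'' (ℓ := ℓ) e
  have hr₂r : r₂ < r := zpow_neg_lt_zpow_neg'' (by omega)
  have hrr : r * r = r₂ := zpow_neg_mul_self e
  have hkey := norm_apply_zero_one_mul_apply_one_zero he hW hWdet
  obtain ⟨w00, w01, w10, w11⟩ := hW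
  obtain ⟨hZint, hZ10⟩ := hZ
  -- the remainder `R`
  have hR : ‖W 0 0 * W 1 1 * Z 1 1 + W 0 0 * W 0 1 * Z 1 0 - W 1 0 * W 1 1 * Z 0 1‖ ≤ r₂ := by
    refine (norm_sub_le_max'' _ _).trans (max_le ((IsUltrametricDist.norm_add_le_max _ _).trans (max_le ?_ ?_)) ?_)
    · exact (norm_mul3_le w00 w11 (hZint 1 1)).trans (by rw [hrr, mul_one])
    · exact (norm_mul3_le w00 w01 hZ10).trans (by rw [mul_one, hrr])
    · exact (norm_mul3_le w10 w11 (hZint 0 1)).trans (by rw [hrr, mul_one])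
  -- the prefactor `ℓ (det W)⁻¹ (det Z)⁻¹` has norm `ℓ^e`
  have hdW0 : W.det ≠ 0 := fun h ↦ by rw [h, norm_zero] at hWdet; exact hr0.ne hWdet
  have hdZ0 : Z.det ≠ 0 := fun h ↦ by rw [h, norm_zero] at hZdet; exact (zpow_neg_pos'' 1).ne hZdet
  have hpre : ‖(ℓ : ℚ_[ℓ]) * ((W.det)⁻¹ * (Z.det)⁻¹)‖ = r⁻¹ := by
    rw [norm_mul, norm_mul, norm_inv, norm_inv, hWdet, hZdet, Padic.norm_p, Nat.cast_one, zpow_neg_one, inv_inv,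
      mul_comm r⁻¹, ← mul_assoc, inv_mul_cancel₀ hℓ0, one_mul]
  have hentry : ((ℓ : ℚ_[ℓ]) • (W⁻¹ * Z⁻¹ * W)) 0 0 =
      ((ℓ : ℚ_[ℓ]) * ((W.det)⁻¹ * (Z.det)⁻¹)) *
        (-(W 0 1 * W 1 0 * Z 0 0) + (W 0 0 * W 1 1 * Z 1 1 + W 0 0 * W 0 1 * Z 1 0 - W 1 0 * W 1 1 * Z 0 1)) := by
    rw [inv_mul_inv_mul_eq_smul, Matrix.smul_apply, Matrix.smul_apply, adjugate_mul_adjugate_mul_apply_zero_zero,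
      smul_eq_mul, smul_eq_mul, ← mul_assoc]
  rw [hentry, norm_mul, hpre]
  constructor
  · -- if `‖Z₀₀‖ < 1` the entry has norm `≤ ℓ⁻¹ < 1`
    intro h
    by_contra hne
    have hlt : ‖Z 0 0‖ ≤ (ℓ : ℝ)⁻¹ := (norm_lt_one_iff_le_inv' _).mp (lt_of_le_of_ne (hZint 0 0) hne)
    have hT : ‖-(W 0 1 * W 1 0 * Z 0 0) + (W 0 0 * W 1 1 * Z 1 1 + W 0 0 * W 0 1 * Z 1 0 - W 1 0 * W 1 1 * Z 0 1)‖ ≤ r * (ℓ : ℝ)⁻¹ := by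
      refine (IsUltrametricDist.norm_add_le_max _ _).trans (max_le ?_ (hR.trans ?_))
      · rw [norm_neg, norm_mul, hkey]; exact mul_le_mul_of_nonneg_left hlt hr0.le
      · rw [← hrr]; refine mul_le_mul_of_nonneg_left ?_ hr0.le
        rw [show r = (ℓ : ℝ) ^ (-(e : ℤ)) from rfl, ← zpow_neg_one]
        exact zpow_le_zpow_right₀ (by exact_mod_cast hℓ.out.one_lt.le) (by omega)
    have : (1 : ℝ) ≤ r⁻¹ * (r * (ℓ : ℝ)⁻¹) := h ▸ mul_le_mul_of_nonneg_left hT (inv_nonneg.mpr hr0.le)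
    rw [← mul_assoc, inv_mul_cancel₀ hr0.ne', one_mul] at this
    have hℓ1 : (ℓ : ℝ)⁻¹ < 1 := inv_lt_one_of_one_lt₀ (by exact_mod_cast hℓ.out.one_lt)
    exact absurd this (not_le.mpr hℓ1)
  · -- if `‖Z₀₀‖ = 1` the main term dominates
    intro h
    have hmain : ‖-(W 0 1 * W 1 0 * Z 0 0)‖ = r := by rw [norm_neg, norm_mul, hkey, h, mul_one]
    rw [IsUltrametricDist.norm_add_eq_max_of_norm_ne_norm, hmain, max_eq_left (hR.trans hr₂r.le), inv_mul_cancel₀ hr0.ne']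
    rw [hmain]; exact ((hR.trans_lt hr₂r).ne).symm

end Summit.BirchSwinnertonDyer.BirchSwinnertonDyer.Theorems.LeafPartnerOrders

end
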